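import Summits.BirchSwinnertonDyer.BirchSwinnertonDyer.Theorems.KatoDescentTamePotSupersingularTameUpperReducibleMazurNodes
import Summits.BirchSwinnertonDyer.BirchSwinnertonDyer.Theorems.KatoDescentTamePotSupersingularTameUpperDefectOfItems
import HarnessLib

/-!
# Route `KatoDescentTamePotSupersingular` (rung K8, sub-rung B4 (t′), cell `bsd-potss`): the reducible-defect
# crux `TameUpperReducibleDefect` (item stmt-BirchSwinnertonDyer-19203) and its parent U₀
# `TameUpperDefectRankZero` (item 19982) BY NAME, with the odd-parity residue SHRUNK TO `p ∈ {3, 5, 7}`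
# (a `--supports … --as helper` file; seat `bsd-potss-k8t-c4` g4; nothing booked, BSD not proved by any of this)

The route-free node file `…TameUpperReducibleMazurNodes.lean` (this seat, g4) shows: granted crux M
(`ReducibleKatoMember`, item 19196 — by definition `O6.KatoMemberShaBoundOfReducible`), Mazur's Thm. (7')
in order form, Cassels' isogeny invariance of the BSD quotient, GZK and modularity (conjuncts 2–4 of
`PublishedInputsTame`), the upper half holds on EVERY reducible (t′) rank-`0` row at `p ≥ 11` — Kato's
member bound has torsion slack `t(W') = 0` there, so no parity and no Cassels–Tate input is needed. Here the
same is stated with the ROUTE DECLS as types: §1 the rows of 19203 at `p ≥ 11` from route items; §2 the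
crux 19203 from M, Mazur, the Ogg–Saito schema (this seat g3: the `ℤ/p²`-member disjunct is void), the
published inputs and the ODD-PARITY ROWS AT `p ≤ 7` only; §3 the parent U₀ (item 19982) by the proved split
glue (`tameUpperDefectRankZero_of_items`: Coates–Sujatha's (A) crux 19413 on the non-CM U₀-ns rows, the
cite-level items 19387 ∧ 19191). CONDITIONAL (audit `proof.conditional`: the named facts Mazur / Ogg–Saito
and the displayed row hypothesis); nothing asserted; NO item is closed.

References: [Mazur1977] Thm. (7') p. 35, Cor. III.(5.2) p. 156; [Kato2004Asterisque] Thm. 12.6 (p. 222),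
Thm. 14.5 (3) (p. 236), Prop. 14.16 (2) (p. 244); [Wuthrich2014] Lemma 14 (p. 396);
[Cassels1965ArithmeticVIII]; [MilneADT2006] Thm. I.7.3; [SilvermanATAEC1994] Exercise 4.40, Thm. IV.10.2,
IV.11.1; [CoatesSujatha2005] Conjecture A; [Miller2011LMS] Def. 1.1.
-/

set_option autoImplicit false
-- sibling precedent (`KatoDescentTamePotSupersingularAssembly.lean`): the directory name repeats the summit name
set_option linter.dupNamespace false

noncomputable section

open scoped Classical

namespace Summit.BirchSwinnertonDyer.BirchSwinnertonDyer.Theorems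

open WeierstrassCurve Literature.NumberTheory.EllipticCurves
  Literature.NumberTheory.EllipticCurves.Rank1Residual
  Literature.NumberTheory.EllipticCurves.Rank1Residual.Typed
  Summit.BirchSwinnertonDyer.Rank1Residual
  Summit.BirchSwinnertonDyer.Rank1Residual.Additive
  Summit.BirchSwinnertonDyer.BirchSwinnertonDyer.Theses.KatoDescentTamePotSupersingular

/-! ## §1 The rows of item 19203 at `p ≥ 11`, defect hypothesis dropped, from route items -/

/-- **Every reducible (t′) rank-`0` row at `p ≥ 11` has the upper half `ord_p #Ш ≤ ord_p #Ш_an`**, granted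
the route items `ReducibleKatoMember` (crux M, item 19196) and `PublishedInputsTame` (its conjuncts GZK,
modularity, Cassels; Kato A160 and Cassels–Tate unused) and Mazur's Thm. (7') in order form for every
elliptic curve over `ℚ` (`hMz`, the tree's named fact `Mazur1977_addOrderOf_le`): the route-free node
`TameUpperReducibleMazurNodes.upperReducible_of_katoMember_of_mazur_of_eleven_le`. These are the rows of
`TameUpperReducibleDefect` at `p ≥ 11` with NO `ℤ/p²` / parity condition. Conditional over items / the named
fact; nothing asserted. [cite: Mazur1977, Thm. (7') p. 35 and Cor. III.(5.2) p. 156]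
[cite: Kato2004Asterisque, Thm. 12.6 (p. 222), Prop. 14.16 (2) (p. 244)] [cite: Cassels1965ArithmeticVIII] -/
theorem tameUpperReducible_eleven_le_of_reducibleKatoMember_of_mazur (h₃ : ReducibleKatoMember)
    (hMz : ∀ (V : WeierstrassCurve ℚ), Mazur1977_addOrderOf_le V) (hP : PublishedInputsTame)
    (W : WeierstrassCurve ℚ) [W.IsElliptic] [W.IsGloballyMinimal] (p : ℕ) [Fact p.Prime]
    (h11 : 11 ≤ p) (hr : W.analyticRank = 0) (hadd : Addv W p) (hT : SubTprime W p)
    (hred : ¬ W.HasIrreducibleModPGaloisRep p) : MissingUpperBoundAt W p :=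
  TameUpperReducibleMazurNodes.upperReducible_of_katoMember_of_mazur_of_eleven_le h₃ hMz hP.2.2.2.1 hP.2.1
    hP.2.2.1 W p h11 hr hadd hT hred

/-! ## §2 The crux `TameUpperReducibleDefect` (item 19203) BY NAME, odd-parity residue at `p ≤ 7` only -/

/-- **Item 19203 `TameUpperReducibleDefect` from crux M, Mazur's Thm. (7'), the Ogg–Saito schema, the
published inputs and the upper half on the reducible (t′) rank-`0` rows with `ord_p #Ш_an` ODD at
`p ∈ {3, 5, 7}`** (type = the route decl verbatim). The `ℤ/p²`-member disjunct is void (`p ≥ 5`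
unconditionally, `p = 3` granted Ogg–Saito — this seat g3), and at `p ≥ 11` the odd-parity rows are
discharged by §1 (Mazur: torsion slack `0` at Kato's member). The residue `hodd7` is, in the BSD-true
world, EMPTY (`#Ш_an = #Ш` is a square); it is closed only by the exact formula at Kato's member (crux M
read with slack `2t`, the kmc seat's `ExactCountReading`). Conditional; nothing asserted; the item is NOT
closed. [cite: Mazur1977, Thm. (7') p. 35 and Cor. III.(5.2) p. 156]
[cite: Kato2004Asterisque, Thm. 12.6 (p. 222), Prop. 14.16 (2) (p. 244)]
[cite: SilvermanATAEC1994, Exercise 4.40 (PDF p. 380), Thm. IV.10.2, IV.11.1] [cite: Cassels1965ArithmeticVIII] -/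
theorem tameUpperReducibleDefect_of_reducibleKatoMember_of_mazur_of_oggSaito_of_oddParityLeSeven
    (h₃ : ReducibleKatoMember) (hMz : ∀ (V : WeierstrassCurve ℚ), Mazur1977_addOrderOf_le V)
    (hOS : ∀ (V : WeierstrassCurve ℚ) (ℓ : ℕ) [Fact ℓ.Prime],
      V.artinConductorExponent_tate_eq_conductorExponent_of_isElliptic ℓ)
    (hP : PublishedInputsTame)
    (hodd7 : ∀ (W : WeierstrassCurve ℚ) [W.IsElliptic] [W.IsGloballyMinimal] (p : ℕ) [Fact p.Prime],
      p ≤ 7 → W.analyticRank = 0 → p ≠ 2 → Addv W p → SubTprime W p → ¬ W.HasIrreducibleModPGaloisRep p →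
      (∃ q : ℚ, shaAn W = (q : ℂ) ∧ ¬ Even (padicValRat p q)) → MissingUpperBoundAt W p) :
    Summit.BirchSwinnertonDyer.BirchSwinnertonDyer.Theses.KatoDescentTamePotSupersingular.TameUpperReducibleDefect :=
  TameUpperReducibleMazurNodes.upperReducibleDefect_of_katoMember_of_mazur_of_oggSaito_of_oddParityLeSeven
    h₃ hMz hOS hP.2.2.2.1 hP.2.1 hP.2.2.1 hodd7

/-! ## §3 The parent U₀ `TameUpperDefectRankZero` (item 19982) BY NAME — the U₀ bill after g4 -/

/-- **Item 19982 `TameUpperDefectRankZero` (U₀ of K8-t′) from: Coates–Sujatha's (A) on the non-CM U₀-ns rows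
(crux `TameFineSelmerCoatesSujatha`, item 19413), crux M (`ReducibleKatoMember`, item 19196), the cite-level
items `PublishedInputsFineSelmerCM` (19387), `KatoTamagawaExactInputs` (19191), `PublishedInputsTame`
(19198), the named facts Mazur Thm. (7') and Ogg–Saito, and the ODD-PARITY reducible rows at
`p ∈ {3, 5, 7}`** — the proved split glue (`tameUpperDefectRankZero_of_items`, items 19204/19202 derived)
applied to §2. So after this seat's g0–g4: U₀(t′) = (A) on the ♯ non-CM irreducible rows + M + the
odd-parity reducible rows at `p ≤ 7` + print. Conditional over items / named facts / the displayed rows;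
nothing asserted; NO item is closed. [cite: Kato2004Asterisque, Thm. 14.5 (3) (p. 236), Prop. 14.16 (2) (p. 244)]
[cite: CoatesSujatha2005, Conjecture A] [cite: Mazur1977, Thm. (7') p. 35] [cite: Cassels1965ArithmeticVIII] -/
theorem tameUpperDefectRankZero_of_items_of_mazur_of_oggSaito_of_oddParityLeSeven
    (hF : PublishedInputsFineSelmerCM) (hK : KatoTamagawaExactInputs) (hCS : TameFineSelmerCoatesSujatha)
    (h₃ : ReducibleKatoMember) (hMz : ∀ (V : WeierstrassCurve ℚ), Mazur1977_addOrderOf_le V)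
    (hOS : ∀ (V : WeierstrassCurve ℚ) (ℓ : ℕ) [Fact ℓ.Prime],
      V.artinConductorExponent_tate_eq_conductorExponent_of_isElliptic ℓ)
    (hP : PublishedInputsTame)
    (hodd7 : ∀ (W : WeierstrassCurve ℚ) [W.IsElliptic] [W.IsGloballyMinimal] (p : ℕ) [Fact p.Prime],
      p ≤ 7 → W.analyticRank = 0 → p ≠ 2 → Addv W p → SubTprime W p → ¬ W.HasIrreducibleModPGaloisRep p →
      (∃ q : ℚ, shaAn W = (q : ℂ) ∧ ¬ Even (padicValRat p q)) → MissingUpperBoundAt W p) :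
    Summit.BirchSwinnertonDyer.BirchSwinnertonDyer.Theses.KatoDescentTamePotSupersingular.TameUpperDefectRankZero :=
  tameUpperDefectRankZero_of_items hF hK hCS
    (tameUpperReducibleDefect_of_reducibleKatoMember_of_mazur_of_oggSaito_of_oddParityLeSeven h₃ hMz hOS hP
      hodd7)

end Summit.BirchSwinnertonDyer.BirchSwinnertonDyer.Theorems

end
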